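import Summits.PneNP.PneNP.Theorems.PairwiseSAPeelStep
import Summits.PneNP.PneNP.Theorems.PstarSAConsistency

/-!
# Biased pairwise-independent Sherali–Adams laws for `k`-local maps, III: consistency and normalisation (T22.0 hub)

FRONTIER range-avoidance ladder, rung F-N3 context — restricted-model bookkeeping for the Sherali–Adams hierarchy
(`PstarSALevel.SAFeasible`); cell `pnp-ideate`, ROUND-22 item T22.0.  Nothing here bears on `P` vs `NP`.

The `k`-ary, law-abstract form of `PstarSAConsistency` (Benabbas–Georgiou–Magen–Tulsiani 2012, Lemma 3.2 / Claim 3.3, with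
`k − 2` private variables per peel):

* `exists_priv` — if `(k−3)·#J < #(bdry J \ T)` some member of `J` has `≥ k − 2` private variables outside `T`;
* `ExpandingOff I T E` — every non-empty `J ⊆ E` has `(k−3)·#J < #(bdry J \ T)` (what `(r, k−3+δ)`-boundary expansion of
  BGMT's `G|−T` gives; from `PstarSASDPLevel.BoundaryExpandingQ a b r I` with `(k−3)·b < a` when `T = ∅`, `#E ≤ r`);
* `sum_cylT_peel`, **`law_consistent`** (`cyl (law S) T = cyl (law T) T` for `T ⊆ S` when `dom S \ dom T` is expanding off
  `T`), **`law_total`** (`Z_S = 1`), `law_total_of_boundaryExpandingQ`.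
-/

set_option linter.dupNamespace false

open Finset Literature.Computability.Complexity
open Summit.PneNP.PneNP.Theorems.PstarPairwise (rho)
open Summit.PneNP.PneNP.Theorems.PstarSALevel (varSet cyl bdry)
open Summit.PneNP.PneNP.Theorems.PstarSASDPLevel (BoundaryExpandingQ)
open Summit.PneNP.PneNP.Theorems.PstarSAPeeling (cylOff mem_cylOff sum_eq_of_cylOff cylT_closed)
open Summit.PneNP.PneNP.Theorems.PairwiseSALevel (PairwiseLaws)

namespace Summit.PneNP.PneNP.Theorems.PairwiseSA

variable {k n m : ℕ}

/-! ## Boundary variables are private variables; the pigeonhole of Claim 3.3 -/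

/-- A private variable of `j ∈ J` is one read by `j` alone among `J`. -/
theorem mem_priv_iff {I : LocalMap k n m} {J : Finset (Fin m)} {j : Fin m} (hj : j ∈ J) {v : Fin n} :
    v ∈ priv I J j ↔ (J.filter fun j' => v ∈ varSet I j') = {j} := by
  rw [priv, mem_filter, eq_singleton_iff_unique_mem]
  simp only [mem_filter]
  constructor
  · rintro ⟨hv, h⟩
    exact ⟨⟨hj, hv⟩, fun j' hj' => by_contra fun hne => h j' hj'.1 hne hj'.2⟩
  · rintro ⟨⟨-, hv⟩, h⟩
    exact ⟨hv, fun j' hj' hne hv' => hne (h j' ⟨hj', hv'⟩)⟩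

/-- A boundary variable of `J` is a private variable of some member of `J`. -/
theorem mem_bdry_iff {I : LocalMap k n m} {J : Finset (Fin m)} {v : Fin n} :
    v ∈ bdry I J ↔ ∃ j ∈ J, v ∈ priv I J j := by
  unfold PstarSALevel.bdry
  rw [mem_filter, card_eq_one]
  simp only [mem_univ, true_and]
  constructor
  · rintro ⟨j, hj⟩
    have hjJ : j ∈ J := (mem_filter.1 (hj ▸ mem_singleton_self j)).1
    exact ⟨j, hjJ, (mem_priv_iff hjJ).2 hj⟩
  · rintro ⟨j, hjJ, hv⟩
    exact ⟨j, (mem_priv_iff hjJ).1 hv⟩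

/-- The boundary outside `T` is covered by the private parts outside `T`. -/
theorem bdry_sdiff_subset (I : LocalMap k n m) (J : Finset (Fin m)) (T : Finset (Fin n)) :
    bdry I J \ T ⊆ J.biUnion fun j => priv I J j \ T := by
  intro v hv
  rw [mem_sdiff, mem_bdry_iff] at hv
  obtain ⟨⟨j, hj, hvj⟩, hvT⟩ := hv
  exact mem_biUnion.2 ⟨j, hj, mem_sdiff.2 ⟨hvj, hvT⟩⟩

/-- **Claim 3.3's step (pigeonhole)**: `(k−3)·#J < #(bdry J \ T)` forces an output with at least `k − 2` private variables
outside `T` (i.e. at most two of its slots are hit from elsewhere or by `T`). -/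
theorem exists_priv {I : LocalMap k n m} {J : Finset (Fin m)} {T : Finset (Fin n)}
    (h : (k - 3) * J.card < (bdry I J \ T).card) : ∃ j ∈ J, k ≤ (priv I J j \ T).card + 2 := by
  by_contra hcon
  push Not at hcon
  have h1 : (bdry I J \ T).card ≤ ∑ j ∈ J, (priv I J j \ T).card :=
    (card_le_card (bdry_sdiff_subset I J T)).trans card_biUnion_le
  have h2 : ∑ j ∈ J, (priv I J j \ T).card ≤ ∑ _j ∈ J, (k - 3) :=
    sum_le_sum fun j hj => by have := hcon j hj; omega
  rw [sum_const, smul_eq_mul] at h2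
  have h3 : J.card * (k - 3) = (k - 3) * J.card := Nat.mul_comm _ _
  omega

/-! ## Expansion off `T` -/

/-- EXPANSION of a family `E` of outputs OFF the variable set `T` (ratio above `k − 3`): every non-empty sub-family `J` has
`(k−3)·#J < #(bdry J \ T)`. -/
def ExpandingOff (I : LocalMap k n m) (T : Finset (Fin n)) (E : Finset (Fin m)) : Prop :=
  ∀ J ⊆ E, J.Nonempty → (k - 3) * J.card < (bdry I J \ T).card

/-- Expansion passes to sub-families. -/
theorem ExpandingOff.mono {I : LocalMap k n m} {T : Finset (Fin n)} {E E' : Finset (Fin m)}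
    (h : ExpandingOff I T E) (hE : E' ⊆ E) : ExpandingOff I T E' :=
  fun J hJ hne => h J (hJ.trans hE) hne

/-- Nothing non-empty lives in the empty family. -/
theorem expandingOff_empty (I : LocalMap k n m) (T : Finset (Fin n)) : ExpandingOff I T ∅ :=
  fun J hJ hne => absurd hne (by rw [subset_empty.1 hJ]; exact not_nonempty_empty)

/-- `(r, a/b)`-boundary expansion with `a/b > k − 3` gives expansion (off `∅`) of every family of at most `r` outputs. -/
theorem expandingOff_of_boundaryExpandingQ {a b r : ℕ} {I : LocalMap k n m} (hab : (k - 3) * b < a)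
    (hB : BoundaryExpandingQ a b r I) {E : Finset (Fin m)} (hE : E.card ≤ r) : ExpandingOff I ∅ E := by
  intro J hJ hne
  have h := hB J ((card_le_card hJ).trans hE)
  have hpos : 0 < J.card := card_pos.2 hne
  rw [sdiff_empty]
  rcases Nat.eq_zero_or_pos b with hb | hb
  · subst hb
    have : a * J.card ≤ 0 := by simpa using h
    have ha : 0 < a := by omega
    have := Nat.eq_zero_of_le_zero this
    rw [Nat.mul_eq_zero] at this
    omega
  · have h1 : b * ((k - 3) * J.card) < b * (bdry I J).card :=
      calc b * ((k - 3) * J.card) = (k - 3) * b * J.card := by ring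
        _ < a * J.card := Nat.mul_lt_mul_of_pos_right hab hpos
        _ ≤ b * (bdry I J).card := h
    exact Nat.lt_of_mul_lt_mul_left h1

/-! ## Peeling an expanding family inside a `T`-cylinder -/

/-- A private variable of `j₀` within `E`, outside `T`, stays private within `dom T ∪ E`. -/
theorem priv_sdiff_subset_priv_union (I : LocalMap k n m) (T : Finset (Fin n)) (E : Finset (Fin m)) (j₀ : Fin m) :
    priv I E j₀ \ T ⊆ priv I (dom I T ∪ E) j₀ := by
  intro v hv
  rw [mem_sdiff] at hv
  obtain ⟨hv, hvT⟩ := hv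
  refine mem_filter.2 ⟨priv_subset I E j₀ hv, fun j hj hne hvj => ?_⟩
  rcases mem_union.1 hj with hj | hj
  · exact hvT (mem_dom.1 hj hvj)
  · exact not_mem_of_mem_priv hv hj hne hvj

/-- An output with a private variable outside `T` is not dominated by `T`. -/
theorem not_mem_dom_of_priv_sdiff {I : LocalMap k n m} {T : Finset (Fin n)} {E : Finset (Fin m)} {j₀ : Fin m}
    (h : (priv I E j₀ \ T).Nonempty) : j₀ ∉ dom I T := by
  obtain ⟨v, hv⟩ := h
  rw [mem_sdiff] at hv
  exact fun hj => hv.2 (mem_dom.1 hj (priv_subset I E j₀ hv.1))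

/-- **BGMT Lemma 3.2, the computation** (`k`-ary, abstract laws; needs `k ≥ 3` so that a peelable output has a free
variable). -/
theorem sum_cylT_peel {I : LocalMap k n m} {y : Fin m → Bool} {p : Fin n → ℝ} {μ : Fin m → (Fin k → Bool) → ℝ}
    (h : PairwiseLaws I y p μ) (hinj : ∀ j, Function.Injective (I.vars j)) (hk : 3 ≤ k) (T : Finset (Fin n)) :
    ∀ (c : ℕ) (E : Finset (Fin m)), E.card = c → ExpandingOff I T E → ∀ a : Fin n → Bool,
      ∑ x ∈ univ.filter (fun x : Fin n → Bool => ∀ i ∈ T, x i = a i), W I p μ (dom I T ∪ E) x =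
        ∑ x ∈ univ.filter (fun x : Fin n → Bool => ∀ i ∈ T, x i = a i), W I p μ (dom I T) x := by
  intro c
  induction c with
  | zero =>
    intro E hE _ a
    rw [card_eq_zero.1 hE, union_empty]
  | succ c ih =>
    intro E hE hexp a
    have hne : E.Nonempty := card_pos.1 (by omega)
    obtain ⟨j₀, hj₀E, h2⟩ := exists_priv (hexp E Subset.rfl hne)
    set F := priv I E j₀ \ T with hF
    have hFne : F.Nonempty := card_pos.1 (by omega)
    have hj₀T : j₀ ∉ dom I T := not_mem_dom_of_priv_sdiff hFne
    have hj₀ : j₀ ∈ dom I T ∪ E := mem_union_right _ hj₀E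
    have hFpriv : F ⊆ priv I (dom I T ∪ E) j₀ := priv_sdiff_subset_priv_union I T E j₀
    have hFT : ∀ v ∈ F, v ∉ T := fun v hv => (mem_sdiff.1 hv).2
    have herase : (dom I T ∪ E).erase j₀ = dom I T ∪ E.erase j₀ := by
      rw [erase_union_distrib, erase_eq_of_notMem hj₀T]
    calc ∑ x ∈ univ.filter (fun x : Fin n → Bool => ∀ i ∈ T, x i = a i), W I p μ (dom I T ∪ E) x
        = ∑ x ∈ univ.filter (fun x : Fin n → Bool => ∀ i ∈ T, x i = a i), W I p μ ((dom I T ∪ E).erase j₀) x :=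
          sum_eq_of_cylOff (cylT_closed hFT a) fun x _ => peel_step h (hinj j₀) hj₀ hFpriv h2 x
      _ = ∑ x ∈ univ.filter (fun x : Fin n → Bool => ∀ i ∈ T, x i = a i), W I p μ (dom I T ∪ E.erase j₀) x := by
          rw [herase]
      _ = ∑ x ∈ univ.filter (fun x : Fin n → Bool => ∀ i ∈ T, x i = a i), W I p μ (dom I T) x :=
          ih (E.erase j₀) (by rw [card_erase_of_mem hj₀E]; omega) (hexp.mono (erase_subset j₀ E)) a

/-! ## Consistency and normalisation of the laws -/

/-- **CONSISTENCY (BGMT Lemma 3.2, biased, `k`-ary).**  If `T ⊆ S` and the outputs dominated by `S` but not by `T` are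
expanding off `T`, then `law S` and `law T` give every `T`-cylinder the same mass. -/
theorem law_consistent {I : LocalMap k n m} {y : Fin m → Bool} {p : Fin n → ℝ} {μ : Fin m → (Fin k → Bool) → ℝ}
    (h : PairwiseLaws I y p μ) (hinj : ∀ j, Function.Injective (I.vars j)) (hk : 3 ≤ k) {S T : Finset (Fin n)}
    (hTS : T ⊆ S) (hexp : ExpandingOff I T (dom I S \ dom I T)) (a : Fin n → Bool) :
    cyl (law I p μ S) T a = cyl (law I p μ T) T a := by
  unfold PstarSALevel.cyl law
  rw [← union_sdiff_of_subset (dom_mono I hTS)]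
  exact sum_cylT_peel h hinj hk T _ _ rfl hexp a

/-- No output is dominated by `∅` when outputs read at least one variable. -/
theorem dom_empty (I : LocalMap k n m) (hk : 0 < k) : dom I ∅ = ∅ := by
  ext j
  simp only [mem_dom, subset_empty, notMem_empty, iff_false]
  intro h
  have hv : I.vars j ⟨0, hk⟩ ∈ varSet I j := mem_image_of_mem _ (mem_univ _)
  rw [h] at hv
  exact notMem_empty _ hv

/-- The weight of the empty family is the bias-product law. -/
theorem W_empty (I : LocalMap k n m) (p : Fin n → ℝ) (μ : Fin m → (Fin k → Bool) → ℝ) (x : Fin n → Bool) :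
    W I p μ ∅ x = ∏ v, rho (p v) (x v) := by
  unfold W ex deg
  simp

/-- The bias-product law has total mass `1`. -/
theorem sum_W_empty (I : LocalMap k n m) (p : Fin n → ℝ) (μ : Fin m → (Fin k → Bool) → ℝ) : ∑ x, W I p μ ∅ x = 1 := by
  have hc : cylOff (univ : Finset (Fin n)) (fun _ => true) = univ :=
    eq_univ_of_forall fun β => mem_cylOff.2 fun v hv => absurd (mem_univ v) hv
  have h := sum_cylOff_prod_rho p univ (fun _ => true)
  rw [hc] at h
  simpa only [W_empty] using h

/-- **NORMALISATION (`Z_S = 1`).**  If the outputs dominated by `S` are expanding (off `∅`), `law S` is a probability law. -/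
theorem law_total {I : LocalMap k n m} {y : Fin m → Bool} {p : Fin n → ℝ} {μ : Fin m → (Fin k → Bool) → ℝ}
    (h : PairwiseLaws I y p μ) (hinj : ∀ j, Function.Injective (I.vars j)) (hk : 3 ≤ k) {S : Finset (Fin n)}
    (hexp : ExpandingOff I ∅ (dom I S)) : ∑ x, law I p μ S x = 1 := by
  have h' := sum_cylT_peel h hinj hk ∅ _ (dom I S) rfl hexp (fun _ => true)
  have hu : univ.filter (fun x : Fin n → Bool => ∀ i ∈ (∅ : Finset (Fin n)), x i = true) = univ :=
    filter_true_of_mem fun x _ => by simp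
  rw [hu, dom_empty I (by omega), empty_union, sum_W_empty] at h'
  exact h'

/-- Normalisation under `(r, a/b)`-boundary expansion with `a/b > k − 3`, for sets dominating at most `r` outputs. -/
theorem law_total_of_boundaryExpandingQ {a b r : ℕ} {I : LocalMap k n m} {y : Fin m → Bool} {p : Fin n → ℝ}
    {μ : Fin m → (Fin k → Bool) → ℝ} (h : PairwiseLaws I y p μ) (hinj : ∀ j, Function.Injective (I.vars j)) (hk : 3 ≤ k)
    (hab : (k - 3) * b < a) (hB : BoundaryExpandingQ a b r I) {S : Finset (Fin n)} (hS : (dom I S).card ≤ r) :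
    ∑ x, law I p μ S x = 1 :=
  law_total h hinj hk (expandingOff_of_boundaryExpandingQ hab hB hS)

end Summit.PneNP.PneNP.Theorems.PairwiseSA
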